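import Summits.HodgeConjecture.HodgeConjecture.Theorems.VHCAbelianSchemesRoadLocallyServed
import Summits.HodgeConjecture.HodgeConjecture.Theorems.VHCAbelianSchemesRoadServedFibre
import HarnessLib

/-!
# Road b02 (`VHCAbelianSchemesRoad`, D-0059) — SPAN DATA AT ANCHORS + REACHABILITY ⟹ LOCALLY SERVED: the kernel glue for a
# skeleton over the local crux cut into «anchored carriers (2a′, 2m′)», «reachability (2τ′)» and «residual pairs (2b′ᴸ)»

research route conditional on HC_CM; not a corollary; Q11.4-sentence-2 already refuted in dim ≥ 3.
(cell line of seat ab-andre-2: research route, not a corollary; conditional on HC_CM plus one named minimal statement.)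

THEOREMS + two predicates with parameters (`AnchoredSpanAt`, a `@[conjecture]` carrier statement per anchor in SPAN form;
`AnchorReachableAt`, a plain per-pair predicate); no named fact, no sorry; `HC_CM` occurs nowhere. Seat ab-andre-2 gen 66, on the
by-name sugar spec of LEAD 160 for skeleton v3.5.1 of the deciding crux stmt-HodgeConjecture-23176
`SemiregularSheafRepresentativesTwPrimeAtDiagLocal` (HOME INBOX «v3.5.1 BY-NAME SUGAR SPEC») and director-hodge l.5420; helper
`--supports stmt-HodgeConjecture-23176`; the route, `closes`, the binders and the registered skeletons are NOT touched. Everything is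
𝒪-GENERIC and cell-generic: the door's invariance under isomorphisms enters as the hypothesis `h𝒪` (for the road's `tw C AdmTw'` it is
`twistedDoorPrime_respectsIso` of `VHCAbelianSchemesRoadTwistedDoorPrimeIsoRespects.lean`, supplied by the skeleton, which imports the route
cone anyway — this file must not).

* §1 `AnchoredSpanAt 𝒪 n p 𝔄 𝔘 𝔏` — at every anchor `(Y, θ)` (`𝔄 Y θ`) and every RATIONAL class `w` of the set `𝔏 Y θ` to be served:
  finitely many `𝒪`-data ON `Y` with side components on the `θ`-rays and degree-`p` classes `κ i p = a' i • u i + cp i • θᵖ`, `u i` RATIONAL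
  members of the «transportable» set `𝔘 Y θ`, spanning `a•w + cθ•θᵖ` — the span form of `AnchoredCarrierAt`. (G1)
  `anchoredSpanAt_of_anchoredCarrierAt_pair`: TWO anchored carrier statements (`AnchoredCarrierAt 𝒪 n p 𝔄 𝔖₁`, `… 𝔖₂`, e.g. print's `𝓔̄`
  for the direction `γ₀` and the mover `(ḡ_u)_*𝓔̄` for `γ₁`) + the linear-algebra clause «every rational `w ∈ 𝔏 Y θ` is
  `x•u₁ + y•u₂ + z•θᵖ` with `u_j ∈ 𝔖_j` rational» ⟹ `AnchoredSpanAt 𝒪 n p 𝔄 (𝔖₁ ∪ 𝔖₂) 𝔏`; one carrier alone serves `𝔏 ⊆ ℂ𝔖₁ + ℂθᵖ`.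
* §2 `AnchorReachableAt n p 𝔄 𝔘 𝔏 X w` — the pair `(X, w)` is ANCHOR-REACHABLE: a pencil `f'` (binders of `LocallyServedAt`) with an anchor
  fibre `eY : X'_{s₁} ≅ Y`, `𝔄 Y θ_Y`, a fibre `eX : X'_{t'} ≅ X`, a global `Θ'` with rational `(1,1)` restrictions and `Θ'|_{s₁} = eY^*θ_Y`,
  GLOBAL fibrewise-`(p,p)` extensions of every rational `u ∈ 𝔘 Y θ_Y`, and a global `G` joining `w` to a rational `w_Y ∈ 𝔏 Y θ_Y`
  (`G|_{t'} = eX^*w`, `G|_{s₁} = eY^*w_Y`). (G2 engine) `LocallyServedAt.of_anchorReachable`: `h𝒪` ∧ `AnchoredSpanAt` ∧ `AnchorReachableAt X w`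
  ⟹ `LocallyServedAt 𝒪 n p X w` — the data transported to `X'_{s₁}`, `V i p := a' i • G_{u i} + cp i • Θ'ᵖ`, `V i q := side i q • Θ'^q`,
  `Z' := cθ • Θ'ᵖ`, `W' := a⁻¹ • (∑ c i • V i p − Z')`, and `W'|_{t'} = eX^*w` because `W'` and `G` agree on the fibre `s₁`
  (`complexBetti_map_fiberι_eq_of_eq_at`, Deligne's constancy of the kernel over a connected base).
* §3 (G2) composition: `lefAtExceptionalRegimeAtLocal_of_anchoredSpan_of_residual` — span data at the anchors + «every non-Lefschetz pair is
  reachable or served» ⟹ `LefAtExceptionalRegimeAtLocal 𝒪 n p` (via `lefAtExceptionalRegimeAtLocal_of_partition` with `𝔓 := AnchorReachableAt`).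

NOT claimed: any carrier, any reachability, anything about `HC_CM`. References: [Bloch1972Semiregularity] Rem. (7.5); [Markman2025SecantWeil]
Thm. 1.4.1, §1.5, Thm. 1.5.1; [vanGeemen1994HodgeAV] §2.4, Thm. 4.11; [DeligneHodgeII1971] Cor. 4.1.2; [VoisinHodgeI2002] Thm. 11.30, §7.1.2;
[Andre1996Motifs] §6.3.
-/

noncomputable section

open CategoryTheory CategoryTheory.Limits AlgebraicGeometry Topology MonoidalCategory CartesianMonoidalCategory

namespace Summit.HodgeConjecture.HodgeConjecture.Ring2.SemiregularRepresentatives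

set_option linter.dupNamespace false -- the cell's namespace repeats the summit name, as in every `Ring2*` file

open Literature.AlgebraicGeometry Literature.AlgebraicGeometry.Motives Literature.AlgebraicGeometry.HodgeTheory
open Literature.AlgebraicTopology.SingularHomology
open Literature.Barriers.HodgeConjecture (divisorClassesSpan)
open Summit.Ventures.HSemireg (ObjClass)

/-! ## §1 Span data at the anchors -/

/-- **`AnchoredSpanAt 𝒪 n p 𝔄 𝔘 𝔏` — THE ANCHORED CARRIER STATEMENT IN SPAN FORM**: at every anchor `(Y, θ)` (`𝔄 Y θ`) and for every
RATIONAL class `w ∈ 𝔏 Y θ`, there are finitely many `𝒪`-admissible data `(I i ∋ p, κ i)` ON `Y` with degree-`p` classes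
`κ i p = a' i • u i + cp i • θᵖ` (`u i ∈ 𝔘 Y θ` rational — the transportable directions, e.g. Weil classes) and side components
`κ i q = side i q • θ^q` (`q ∈ I i`, `q ≠ p`) on the `θ`-rays, a scalar `a ≠ 0` and `cθ` with `a•w + cθ•θᵖ = ∑ i, c i • κ i p`.
`AnchoredCarrierAt` is the case `k = 1`, `u = w` (§1 below). OPEN in the intended instance (two carriers at Markman's pinned anchors, the
second conditional on `L1″`); a HYPOTHESIS wherever used. [cite: Bloch1972Semiregularity, Remark (7.5)]
[cite: Markman2025SecantWeil, Thm. 1.4.1 and §1.5] -/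
@[conjecture] def AnchoredSpanAt (𝒪 : ObjClass) (n p : ℕ) (𝔄 : ∀ X : SchemeOver ℂ, complexBetti X 2 → Prop)
    (𝔘 𝔏 : ∀ (X : SchemeOver ℂ), complexBetti X 2 → Set (complexBetti X (2 * p))) : Prop :=
  ∀ (Y : SchemeOver ℂ) (θ : complexBetti Y 2), 𝔄 Y θ → ∀ w ∈ 𝔏 Y θ, IsRationalClass w →
    ∃ (k : ℕ) (I : Fin k → Finset ℕ) (κ : Fin k → (q : ℕ) → complexBetti Y (2 * q)) (u : Fin k → complexBetti Y (2 * p))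
      (a' cp c : Fin k → ℂ) (side : Fin k → ℕ → ℂ) (a cθ : ℂ),
      (∀ i, p ∈ I i ∧ 𝒪 n Y (I i) (κ i) ∧ u i ∈ 𝔘 Y θ ∧ IsRationalClass (u i) ∧
        κ i p = a' i • u i + cp i • cupPowTwo θ p ∧ ∀ q ∈ I i, q ≠ p → κ i q = side i q • cupPowTwo θ q) ∧
      a ≠ 0 ∧ a • w + cθ • cupPowTwo θ p = ∑ i, c i • κ i p

variable {𝒪 : ObjClass} {n p : ℕ} {𝔄 : ∀ X : SchemeOver ℂ, complexBetti X 2 → Prop}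
  {𝔖₁ 𝔖₂ 𝔘 𝔏 : ∀ (X : SchemeOver ℂ), complexBetti X 2 → Set (complexBetti X (2 * p))}

/-- **ONE anchored carrier statement serves, in span form, every rational class on «its directions + the `θᵖ`-ray»**: if every
rational `w ∈ 𝔏 Y θ` is `x•u + z•θᵖ` with `u ∈ 𝔖 Y θ` rational, then `AnchoredCarrierAt 𝒪 n p 𝔄 𝔖 ⟹ AnchoredSpanAt 𝒪 n p 𝔄 𝔖 𝔏`
(`k = 1`). [cite: Bloch1972Semiregularity, Remark (7.5)] [cite: Markman2025SecantWeil, Thm. 1.4.1] -/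
theorem anchoredSpanAt_of_anchoredCarrierAt (hA : AnchoredCarrierAt 𝒪 n p 𝔄 𝔖₁)
    (hspan : ∀ (Y : SchemeOver ℂ) (θ : complexBetti Y 2), 𝔄 Y θ → ∀ w ∈ 𝔏 Y θ, IsRationalClass w →
      ∃ u ∈ 𝔖₁ Y θ, IsRationalClass u ∧ ∃ x z : ℂ, w = x • u + z • cupPowTwo θ p) :
    AnchoredSpanAt 𝒪 n p 𝔄 𝔖₁ 𝔏 := by
  intro Y θ hY w hw hwQ
  obtain ⟨u, hu, huQ, x, z, hwuz⟩ := hspan Y θ hY w hw hwQ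
  obtain ⟨I, κ, a, c, hpI, h𝒪, ha, hκp, hκq⟩ := hA Y θ hY u hu huQ
  refine ⟨1, fun _ ↦ I, fun _ ↦ κ, fun _ ↦ u, fun _ ↦ a, fun _ ↦ c p, fun _ ↦ x / a, fun _ ↦ c, 1, (x / a) * c p - z,
    fun _ ↦ ⟨hpI, h𝒪, hu, huQ, hκp, hκq⟩, one_ne_zero, ?_⟩
  simp only [Fin.sum_univ_one, one_smul]
  rw [hκp, hwuz, smul_add, smul_smul, smul_smul, div_mul_cancel₀ x ha, sub_smul, add_add_sub_cancel]

/-- **(G1) TWO anchored carrier statements serve, in span form, every rational class on «their directions + the `θᵖ`-ray»**: if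
every rational `w ∈ 𝔏 Y θ` is `x•u₁ + y•u₂ + z•θᵖ` with `u_j ∈ 𝔖_j Y θ` rational, then
`AnchoredCarrierAt 𝒪 n p 𝔄 𝔖₁ ∧ AnchoredCarrierAt 𝒪 n p 𝔄 𝔖₂ ⟹ AnchoredSpanAt 𝒪 n p 𝔄 (𝔖₁ ∪ 𝔖₂) 𝔏` (`k = 2`; at `(6,3)`, `d = 4`: print's `𝓔̄`
for `γ₀` and the mover `(ḡ_u)_*𝓔̄` for `γ₁`, ring2-b03x THEOREM M (a)). [cite: Markman2025SecantWeil, Thm. 1.4.1 and §1.5]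
[cite: Bloch1972Semiregularity, Remark (7.5)] -/
theorem anchoredSpanAt_of_anchoredCarrierAt_pair (hA₁ : AnchoredCarrierAt 𝒪 n p 𝔄 𝔖₁) (hA₂ : AnchoredCarrierAt 𝒪 n p 𝔄 𝔖₂)
    (hspan : ∀ (Y : SchemeOver ℂ) (θ : complexBetti Y 2), 𝔄 Y θ → ∀ w ∈ 𝔏 Y θ, IsRationalClass w →
      ∃ u₁ ∈ 𝔖₁ Y θ, ∃ u₂ ∈ 𝔖₂ Y θ, IsRationalClass u₁ ∧ IsRationalClass u₂ ∧
        ∃ x y z : ℂ, w = x • u₁ + y • u₂ + z • cupPowTwo θ p) :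
    AnchoredSpanAt 𝒪 n p 𝔄 (fun Y θ ↦ 𝔖₁ Y θ ∪ 𝔖₂ Y θ) 𝔏 := by
  intro Y θ hY w hw hwQ
  obtain ⟨u₁, hu₁, u₂, hu₂, hu₁Q, hu₂Q, x, y, z, hw'⟩ := hspan Y θ hY w hw hwQ
  obtain ⟨I₁, κ₁, a₁, c₁, hpI₁, h𝒪₁, ha₁, hκp₁, hκq₁⟩ := hA₁ Y θ hY u₁ hu₁ hu₁Q
  obtain ⟨I₂, κ₂, a₂, c₂, hpI₂, h𝒪₂, ha₂, hκp₂, hκq₂⟩ := hA₂ Y θ hY u₂ hu₂ hu₂Q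
  refine ⟨2, ![I₁, I₂], ![κ₁, κ₂], ![u₁, u₂], ![a₁, a₂], ![c₁ p, c₂ p], ![x / a₁, y / a₂], ![c₁, c₂], 1,
    (x / a₁) * c₁ p + (y / a₂) * c₂ p - z, fun i ↦ ?_, one_ne_zero, ?_⟩
  · fin_cases i
    · exact ⟨hpI₁, h𝒪₁, Set.mem_union_left _ hu₁, hu₁Q, hκp₁, hκq₁⟩
    · exact ⟨hpI₂, h𝒪₂, Set.mem_union_right _ hu₂, hu₂Q, hκp₂, hκq₂⟩
  · simp only [Fin.sum_univ_two, one_smul, Matrix.cons_val_zero, Matrix.cons_val_one]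
    rw [hκp₁, hκp₂, hw', smul_add, smul_add, smul_smul, smul_smul, smul_smul, smul_smul, div_mul_cancel₀ x ha₁,
      div_mul_cancel₀ y ha₂, sub_smul, add_smul]
    abel

/-! ## §2 Reachability from an anchor and the transport engine -/

/-- **`AnchorReachableAt n p 𝔄 𝔘 𝔏 X w` — the pair `(X, w)` is ANCHOR-REACHABLE** (plain predicate on the pair, nothing asserted): there are
a pencil `f' : 𝒳' ⟶ S'` (smooth projective family of relative dimension `n`, quasi-projective total space, over a smooth irreducible affine
curve), an ANCHOR fibre `eY : X'_{s₁} ≅ Y` with `𝔄 Y θ_Y`, a fibre `eX : X'_{t'} ≅ X`, a global class `Θ'` with rational `(1,1)` restrictions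
and `Θ'|_{s₁} = eY^* θ_Y` (it carries the `θ`-ray side components), for every rational `u ∈ 𝔘 Y θ_Y` a GLOBAL class on `𝒳'` of type
`(p,p)` on every fibre restricting to `eY^* u` at `s₁` (the transportable directions extend — on a Weil-cell pencil inside the Shimura
variety `W_K` is a constant system), and a global `G` joining `w` to a rational `w_Y ∈ 𝔏 Y θ_Y`: `G|_{t'} = eX^* w`, `G|_{s₁} = eY^* w_Y`.
[cite: Markman2025SecantWeil, §1.5 and Thm. 1.5.1] [cite: Andre1996Motifs, §6.3] [cite: DeligneHodgeII1971, Cor. 4.1.2] -/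
def AnchorReachableAt (n p : ℕ) (𝔄 : ∀ X : SchemeOver ℂ, complexBetti X 2 → Prop)
    (𝔘 𝔏 : ∀ (X : SchemeOver ℂ), complexBetti X 2 → Set (complexBetti X (2 * p))) (X : SchemeOver ℂ)
    (w : complexBetti X (2 * p)) : Prop :=
  ∃ (𝒳' S' : SchemeOver ℂ) (f' : 𝒳' ⟶ S') (s₁ t' : ComplexPoints S') (Y : SchemeOver ℂ) (θY : complexBetti Y 2)
    (eY : fiberOver f' s₁ ≅ Y) (eX : fiberOver f' t' ≅ X) (Θ' : complexBetti 𝒳' 2) (wY : complexBetti Y (2 * p))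
    (G : complexBetti 𝒳' (2 * p)),
    IsSmoothProjectiveFamily f' n ∧ IsQuasiProjectiveOver 𝒳' ∧ IrreducibleSpace S'.left ∧ IsAffine S'.left ∧
    AlgebraicGeometry.Smooth S'.hom ∧ topologicalKrullDim S'.left = 1 ∧
    𝔄 Y θY ∧
    (∀ u : ComplexPoints S', IsRationalClass (complexBetti.map (fiberι f' u) 2 Θ')) ∧
    (∀ u : ComplexPoints S', IsOfHodgeType n (fiberOver f' u) 2 1 1 (complexBetti.map (fiberι f' u) 2 Θ')) ∧
    complexBetti.map (fiberι f' s₁) 2 Θ' = complexBetti.map eY.hom 2 θY ∧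
    (∀ u₀ ∈ 𝔘 Y θY, IsRationalClass u₀ → ∃ Gu : complexBetti 𝒳' (2 * p),
      complexBetti.map (fiberι f' s₁) (2 * p) Gu = complexBetti.map eY.hom (2 * p) u₀ ∧
      ∀ u : ComplexPoints S', IsOfHodgeType n (fiberOver f' u) (2 * p) p p (complexBetti.map (fiberι f' u) (2 * p) Gu)) ∧
    wY ∈ 𝔏 Y θY ∧ IsRationalClass wY ∧
    complexBetti.map (fiberι f' s₁) (2 * p) G = complexBetti.map eY.hom (2 * p) wY ∧
    complexBetti.map (fiberι f' t') (2 * p) G = complexBetti.map eX.hom (2 * p) w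

variable {X : SchemeOver ℂ}

/-- **(G2, engine) SPAN DATA AT THE ANCHORS + REACHABILITY ⟹ LOCALLY SERVED** (door respecting isomorphisms; door-, degree-, anchor-generic;
fact-free). The span datum for `w_Y` at the anchor `(Y, θ_Y)` is transported to the anchor fibre `X'_{s₁}` (`h𝒪`); its classes extend
along `f'`: `V i p := a' i • G_{u i} + cp i • Θ'ᵖ` (the reachability extensions of the `u i` and the powers of `Θ'`, fibrewise `(p,p)`),
`V i q := side i q • Θ'^q`; `Z' := cθ • Θ'ᵖ` is algebraic-Lefschetz on every fibre; `W' := a⁻¹ • (∑ i, c i • V i p − Z')` satisfies the span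
equation by construction and agrees with the joining class `G` on the fibre `s₁`, hence on every fibre
(`complexBetti_map_fiberι_eq_of_eq_at`), so `W'|_{t'} = G|_{t'} = eX^* w`. [cite: Bloch1972Semiregularity, Remark (7.5)]
[cite: Markman2025SecantWeil, Thm. 1.4.1 and Thm. 1.5.1] [cite: DeligneHodgeII1971, Cor. 4.1.2] [cite: VoisinHodgeI2002, Thm. 11.30 and §7.1.2] -/
theorem LocallyServedAt.of_anchorReachable
    (h𝒪 : ∀ (n : ℕ) ⦃Y Y' : SchemeOver ℂ⦄ (e : Y' ≅ Y) (I : Finset ℕ) (κ : (q : ℕ) → complexBetti Y (2 * q)),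
      𝒪 n Y I κ → 𝒪 n Y' I (fun q ↦ complexBetti.map e.hom (2 * q) (κ q)))
    (hspan : AnchoredSpanAt 𝒪 n p 𝔄 𝔘 𝔏) {w : complexBetti X (2 * p)} (hreach : AnchorReachableAt n p 𝔄 𝔘 𝔏 X w) :
    LocallyServedAt 𝒪 n p X w := by
  obtain ⟨𝒳', S', f', s₁, t', Y, θY, eY, eX, Θ', wY, G, hf', h𝒳', hirr', haff', hsm', hdim', hY, hΘQ, hΘH, hΘs₁, hext, hwY, hwYQ,
    hGs₁, hGt'⟩ := hreach
  obtain ⟨k, I, κ, u, a', cp, c, side, a, cθ, hdat, ha, hsum⟩ := hspan Y θY hY wY hwY hwYQ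
  haveI := hirr'
  haveI := hsm'
  haveI : LocallyOfFiniteType S'.hom := inferInstance
  haveI : ConnectedSpace (ComplexPoints S') := connectedSpace_complexPoints_of_irreducibleSpace S'
  -- global extensions of the transportable directions `u i`
  choose Gu hGus₁ hGuH using fun i ↦ hext (u i) (hdat i).2.2.1 (hdat i).2.2.2.1
  -- powers of `Θ'` restrict to powers of the restriction
  have hΘpow : ∀ (v : ComplexPoints S') (q : ℕ),
      complexBetti.map (fiberι f' v) (2 * q) (cupPowTwo Θ' q) = cupPowTwo (complexBetti.map (fiberι f' v) 2 Θ') q :=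
    fun v q ↦ map_cupPowTwo _ Θ' q
  have heYpow : ∀ q : ℕ, complexBetti.map eY.hom (2 * q) (cupPowTwo θY q) = cupPowTwo (complexBetti.map eY.hom 2 θY) q :=
    fun q ↦ map_cupPowTwo _ θY q
  -- the global classes of the transported data
  let V : Fin k → (q : ℕ) → complexBetti 𝒳' (2 * q) := fun i ↦
    Function.update (fun q ↦ side i q • cupPowTwo Θ' q) p (a' i • Gu i + cp i • cupPowTwo Θ' p)
  have hVp : ∀ i, V i p = a' i • Gu i + cp i • cupPowTwo Θ' p := fun i ↦ Function.update_self _ _ _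
  have hVq : ∀ i q, q ≠ p → V i q = side i q • cupPowTwo Θ' q := fun i q hq ↦ Function.update_of_ne hq _ _
  let Z : complexBetti 𝒳' (2 * p) := cθ • cupPowTwo Θ' p
  let W' : complexBetti 𝒳' (2 * p) := a⁻¹ • (∑ i, c i • V i p - Z)
  -- restrictions to the anchor fibre of the pieces
  have hZs₁ : complexBetti.map (fiberι f' s₁) (2 * p) (cθ • cupPowTwo Θ' p) =
      complexBetti.map eY.hom (2 * p) (cθ • cupPowTwo θY p) := by
    rw [map_smul, map_smul, hΘpow s₁ p, hΘs₁, heYpow p]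
  have hVs₁ : ∀ i, complexBetti.map (fiberι f' s₁) (2 * p) (V i p) = complexBetti.map eY.hom (2 * p) (κ i p) := by
    intro i
    rw [hVp i, map_add, map_smul, map_smul, hGus₁ i, hΘpow s₁ p, hΘs₁, ← heYpow p, (hdat i).2.2.2.2.1, map_add, map_smul,
      map_smul]
  have hsum' : a • complexBetti.map eY.hom (2 * p) wY =
      ∑ i, c i • complexBetti.map eY.hom (2 * p) (κ i p) - cθ • complexBetti.map eY.hom (2 * p) (cupPowTwo θY p) := by
    have h := congrArg (complexBetti.map eY.hom (2 * p)) hsum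
    rw [map_add, map_smul, map_smul, map_sum] at h
    simp_rw [map_smul] at h
    rw [eq_sub_iff_add_eq]
    exact h
  -- `W'` agrees with the joining class `G` on the anchor fibre, hence on every fibre
  have hW's₁ : complexBetti.map (fiberι f' s₁) (2 * p) W' = complexBetti.map (fiberι f' s₁) (2 * p) G := by
    change complexBetti.map (fiberι f' s₁) (2 * p) (a⁻¹ • (∑ i, c i • V i p - cθ • cupPowTwo Θ' p)) = _
    rw [map_smul, map_sub, map_sum, hZs₁]
    simp_rw [map_smul, hVs₁]
    rw [← hsum', smul_smul, inv_mul_cancel₀ ha, one_smul, hGs₁]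
  have hW't' : complexBetti.map (fiberι f' t') (2 * p) W' = complexBetti.map eX.hom (2 * p) w := by
    rw [complexBetti_map_fiberι_eq_of_eq_at f' hf' hW's₁ t', hGt']
  refine ⟨𝒳', S', f', t', eX, W', k, fun _ ↦ s₁, I, fun i q ↦ complexBetti.map eY.hom (2 * q) (κ i q), V, c, a, Z,
    hf', h𝒳', hirr', haff', hsm', hdim', hW't'.symm, fun i ↦ ⟨(hdat i).1, h𝒪 n eY (I i) (κ i) (hdat i).2.1, fun q hq ↦ ?_,
      fun q hq v ↦ ?_⟩, ha, fun v ↦ ⟨?_, ?_⟩, ?_⟩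
  · -- pinning at the anchor fibre: `eY^*(κ i q) = V i q|_{s₁}`
    show complexBetti.map eY.hom (2 * q) (κ i q) = complexBetti.map (fiberι f' s₁) (2 * q) (V i q)
    by_cases hqp : q = p
    · subst hqp
      exact (hVs₁ i).symm
    · rw [hVq i q hqp, map_smul, hΘpow s₁ q, hΘs₁, ← heYpow q, (hdat i).2.2.2.2.2 q hq hqp, map_smul]
  · -- `V i q` is of type `(q,q)` on every fibre
    by_cases hqp : q = p
    · subst hqp
      rw [hVp i, map_add, map_smul]
      exact ((hGuH i v).smul (a' i)).add (hf'.isSmoothProjective v) (isOfHodgeType_map_smul_cupPowTwo hf' Θ' v (hΘH v) (cp i) q)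
    · rw [hVq i q hqp]
      exact isOfHodgeType_map_smul_cupPowTwo hf' Θ' v (hΘH v) (side i q) q
  · -- `Z' = cθ • Θ'ᵖ` is algebraic on every fibre
    exact divisorClassesSpan_le_algebraicClasses_of_isSmoothProjective (hf'.isSmoothProjective v) p
      (smul_cupPowTwo_map_mem_divisorClassesSpan Θ' v (hΘQ v) (hΘH v) cθ p)
  · -- … and Lefschetz
    exact smul_cupPowTwo_map_mem_divisorClassesSpan Θ' v (hΘQ v) (hΘH v) cθ p
  · -- the span equation holds by construction of `W'`
    change a • (a⁻¹ • (∑ i, c i • V i p - Z)) + Z = ∑ i, c i • V i p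
    rw [smul_smul, mul_inv_cancel₀ ha, one_smul, sub_add_cancel]

/-! ## §3 (G2) Composition: span data at the anchors + «every non-Lefschetz pair is reachable or served» ⟹ the local regime -/

/-- **Span data at the anchors and reachability of EVERY `𝔓`-pair give the stub «`𝔓`-pairs are locally served»** (door respecting
isomorphisms). [cite: Markman2025SecantWeil, Thm. 1.5.1] [cite: Bloch1972Semiregularity, Remark (7.5)] -/
theorem locallyServed_pairs_of_anchoredSpan_of_reachable {𝔓 : ∀ X : SchemeOver ℂ, complexBetti X (2 * p) → Prop}
    (h𝒪 : ∀ (n : ℕ) ⦃Y Y' : SchemeOver ℂ⦄ (e : Y' ≅ Y) (I : Finset ℕ) (κ : (q : ℕ) → complexBetti Y (2 * q)),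
      𝒪 n Y I κ → 𝒪 n Y' I (fun q ↦ complexBetti.map e.hom (2 * q) (κ q)))
    (hspan : AnchoredSpanAt 𝒪 n p 𝔄 𝔘 𝔏)
    (hreach : ∀ (X : SchemeOver ℂ), (∃ A' : AbelianVariety ℂ, A'.dim = n ∧ Nonempty (A'.X ≅ X)) →
      ∀ w : complexBetti X (2 * p), IsRationalClass w → IsOfHodgeType n X (2 * p) p p w → 𝔓 X w → AnchorReachableAt n p 𝔄 𝔘 𝔏 X w) :
    ∀ (X : SchemeOver ℂ), (∃ A' : AbelianVariety ℂ, A'.dim = n ∧ Nonempty (A'.X ≅ X)) →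
      ∀ w : complexBetti X (2 * p), IsRationalClass w → IsOfHodgeType n X (2 * p) p p w → 𝔓 X w → LocallyServedAt 𝒪 n p X w :=
  fun X hX w hwQ hwH hP ↦ LocallyServedAt.of_anchorReachable h𝒪 hspan (hreach X hX w hwQ hwH hP)

/-- **(G2) THE LOCAL REGIME AT `(n, p)` FROM SPAN DATA AT THE ANCHORS AND THE RESIDUAL** (door respecting isomorphisms): if
`AnchoredSpanAt 𝒪 n p 𝔄 𝔘 𝔏` holds and every pair `(X, w)` (`X` isomorphic to an abelian `n`-fold, `w` rational of type `(p,p)`) whose class is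
NOT algebraic-Lefschetz is EITHER anchor-reachable OR locally served outright (the residual stub), then `LefAtExceptionalRegimeAtLocal 𝒪 n p`.
The shape of skeleton v3.5.1 at `(6, 3)`: 2a′ ∧ 2m′ (+ THEOREM M (a)) ⟹ `AnchoredSpanAt` by (G1); 2τ′ = reachability of the Weil-type pairs;
2b′ᴸ = the residual pairs. [cite: vanGeemen1994HodgeAV, §2.4 and Thm. 4.11] [cite: Markman2025SecantWeil, Thm. 1.4.1 and Thm. 1.5.1]
[cite: Bloch1972Semiregularity, Remark (7.5)] -/
theorem lefAtExceptionalRegimeAtLocal_of_anchoredSpan_of_residual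
    (h𝒪 : ∀ (n : ℕ) ⦃Y Y' : SchemeOver ℂ⦄ (e : Y' ≅ Y) (I : Finset ℕ) (κ : (q : ℕ) → complexBetti Y (2 * q)),
      𝒪 n Y I κ → 𝒪 n Y' I (fun q ↦ complexBetti.map e.hom (2 * q) (κ q)))
    (hspan : AnchoredSpanAt 𝒪 n p 𝔄 𝔘 𝔏)
    (hres : ∀ (X : SchemeOver ℂ), (∃ A' : AbelianVariety ℂ, A'.dim = n ∧ Nonempty (A'.X ≅ X)) →
      ∀ w : complexBetti X (2 * p), IsRationalClass w → IsOfHodgeType n X (2 * p) p p w →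
        ¬ (w ∈ algebraicClasses X p ∧ w ∈ divisorClassesSpan X n p) → ¬ AnchorReachableAt n p 𝔄 𝔘 𝔏 X w →
        LocallyServedAt 𝒪 n p X w) :
    LefAtExceptionalRegimeAtLocal 𝒪 n p :=
  lefAtExceptionalRegimeAtLocal_of_partition (AnchorReachableAt n p 𝔄 𝔘 𝔏)
    (fun _ _ _ _ _ hP ↦ LocallyServedAt.of_anchorReachable h𝒪 hspan hP) hres

/-- **The same with a named class `𝔓` of pairs (e.g. «Weil-type pair») carrying the reachability stub**: `AnchoredSpanAt` ∧ «every `𝔓`-pair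
is anchor-reachable» ∧ «every non-`𝔓`, non-Lefschetz pair is locally served» ⟹ `LefAtExceptionalRegimeAtLocal 𝒪 n p`.
[cite: vanGeemen1994HodgeAV, §2.4 and Thm. 4.11] [cite: Markman2025SecantWeil, Thm. 1.5.1] -/
theorem lefAtExceptionalRegimeAtLocal_of_anchoredSpan_of_reachable_of_residual {𝔓 : ∀ X : SchemeOver ℂ, complexBetti X (2 * p) → Prop}
    (h𝒪 : ∀ (n : ℕ) ⦃Y Y' : SchemeOver ℂ⦄ (e : Y' ≅ Y) (I : Finset ℕ) (κ : (q : ℕ) → complexBetti Y (2 * q)),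
      𝒪 n Y I κ → 𝒪 n Y' I (fun q ↦ complexBetti.map e.hom (2 * q) (κ q)))
    (hspan : AnchoredSpanAt 𝒪 n p 𝔄 𝔘 𝔏)
    (hreach : ∀ (X : SchemeOver ℂ), (∃ A' : AbelianVariety ℂ, A'.dim = n ∧ Nonempty (A'.X ≅ X)) →
      ∀ w : complexBetti X (2 * p), IsRationalClass w → IsOfHodgeType n X (2 * p) p p w → 𝔓 X w → AnchorReachableAt n p 𝔄 𝔘 𝔏 X w)
    (hres : ∀ (X : SchemeOver ℂ), (∃ A' : AbelianVariety ℂ, A'.dim = n ∧ Nonempty (A'.X ≅ X)) →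
      ∀ w : complexBetti X (2 * p), IsRationalClass w → IsOfHodgeType n X (2 * p) p p w →
        ¬ (w ∈ algebraicClasses X p ∧ w ∈ divisorClassesSpan X n p) → ¬ 𝔓 X w → LocallyServedAt 𝒪 n p X w) :
    LefAtExceptionalRegimeAtLocal 𝒪 n p :=
  lefAtExceptionalRegimeAtLocal_of_partition 𝔓 (locallyServed_pairs_of_anchoredSpan_of_reachable h𝒪 hspan hreach) hres

end Summit.HodgeConjecture.HodgeConjecture.Ring2.SemiregularRepresentatives

end
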